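/-
Copyright (c) 2026 the pub-hodgecm-mathlib formalisation cell (harness21).  Prover seat hodgecm-mathlib-K2E1-p13 (g0), Track B ∕ K2-LIT, h413 = `stmt-HodgeConjecture-24833`,
line `K2_E1_TraceFormulaBeta`, campaign «R8₂-sph EXHAUSTION», ROAD T′ «MS-BOUND CONTOUR SHIFT, ζ-FREE» (dealer K2E1-plan (g6) ruling (77) 2026-09-04T10:30:32Z = K2E1-p09 (g6)'s
ROADCARD `K2/K2E1-p09/g6/ROADCARD-R8-EXHAUSTION-SPH-2.K2E1-p09-g6.md` §3 FILE 1), step T1: the scattering scalar `c(z)` of `U(1,1)_{L∕L⁺}` is BOUNDED on `½ < Re z ≤ σ₀`, `|Im z| ≥ 1`,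
from the Maass–Selberg inequality ALONE — pure real algebra, no ζ-input.
-/
import Summits.HodgeConjecture.HodgeConjecture.Theorems.K2E1MaassSelbergPoleInequality   -- ★ p857974 (K2E4-p10): the scalar Maass–Selberg currency `0 ≤ aT^{2x}∕(2x) − bT^{−2x}∕(2x) + c`, `|c| ≤ √(ab)∕|y|`
import Summits.HodgeConjecture.HodgeConjecture.Theorems.K2E1MaassSelbergPairingFamilyCMTwo    -- ★ p859344 (K2E4-p11): the operator-road socket `poleControl_continued_cm_two_of_family[_lower]` ((a2) box bound on `D±`)
import HarnessLib

/-!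
# R8₂-sph ROAD T′, T1 — `K2E1ScatteringBoundMaassSelbergU2`: `‖c(z)‖ ≤ B` on the strip `½ < Re z ≤ σ₀`, `|Im z| ≥ 1`, from the Maass–Selberg inequality
# `‖c(z)‖² ≤ T₀^{4σ−2} + (2σ−1)·‖c(z)‖·T₀^{2σ−1}∕|t|` (pure real algebra; ζ-free)

Track B ∕ K2-LIT, crux h413 = `stmt-HodgeConjecture-24833`, route of record `HCCMUnconditional`; cell `hodgecm-mathlib`, squad K2, ENGINE E1.  THEOREMS ONLY (no `def`, no `instance`,
no `notation`, no `sorry`; default heartbeats); lane `--supports stmt-HodgeConjecture-24833 --as helper` (count-neutral).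
THE MATHEMATICS (ROADCARD §2 KEY REMARK; [Iwaniec2002, §6.3 and p. 103 «Φ(s) is bounded in ½ ≤ Re s ≤ ½ + ε»]; [Langlands1976, §7]; [MoeglinWaldspurger1995, IV.2.3, IV.3.12]).  For
`z = σ + it`, `½ < σ`, `t ≠ 0`, `T ≥ 1`, the Maass–Selberg relation for the (continued) truncated spherical Eisenstein series of `U(1,1)` at `z′ = z` reads
`0 ≤ ‖Λ^T E_z‖² = a·T^{2x}∕(2x) − a‖c(z)‖²·T^{−2x}∕(2x) + Im(W·T^{2it})∕t`, `x = σ − ½`, `a = κ·m·|φ₀|² > 0`, `‖W‖ ≤ a‖c(z)‖` (★ p857974 ∕ ★ p857990 currency), whence (§3)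
**`‖c(z)‖² ≤ T^{4x} + 2x·‖c(z)‖·T^{2x}∕|t|`**; with `T = T₀` fixed, `|t| ≥ 1` and the real-algebra lemma `s² ≤ A + B·s ⇒ s ≤ B + √A` (§1) this gives (§2)
**`‖c(z)‖ ≤ (2σ₀ − 2ρ₀)·T₀^{2σ₀−2ρ₀} + T₀^{2σ₀−2ρ₀}`** uniformly on `ρ₀ < σ ≤ σ₀`, `|t| ≥ 1` (`ρ₀ = ½` for `U(1,1)`, `ρ₀ = 1` for `U(2,1)`) — the growth input of the contour shift T4, with NO
ζ-function, no zero-free region, no Stirling.  §4 records the same bound read off the «box» conclusion (a2) of the ★ pole-control theorems (`κ·m·‖c z‖²·‖φ₀‖² ≤ M` on the strip ⇒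
`‖c z‖ ≤ √(M ∕ (κ m ‖φ₀‖²))`), which is how T1 is PAID today modulo the operator-road socket ★ p859344 (`poleControl_continued_cm_two_of_family[_lower]`).
* §1 `le_add_sqrt_of_sq_le` (`s² ≤ A + B s ⇒ s ≤ B + √A`).
* §2 `exists_norm_le_of_maassSelberg_ineq` (rank parameter `ρ₀`), HEAD **`norm_intertwiningScalar_le_of_maassSelberg`** (`ρ₀ = ½`, the ROADCARD's FILE 1 bytes), `…_three` (`ρ₀ = 1`).
* §3 `sq_le_of_maassSelbergDiag` — the hypothesis `hMS` of §2 from the scalar Maass–Selberg currency of ★ p857974 (`maassSelbergDiag_of_fourTerm` output + `abs_im_mul_div_le`).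
* §4 `exists_norm_le_of_box_bound` — the same uniform bound from an (a2)-shaped box bound.
* §5 **`exists_norm_intertwiningScalar_le_of_family`** — T1 PAID at `N = 2` modulo the operator-road socket ★ p859344 (`F₊` on `D⁺`, `F₋` on `D⁻`; structural data of ★ (R6k)₂).
HONEST LABEL: HC_CM is proved only modulo the 7 printed citations (2 remaining named inputs: hLiu418 = `stmt-HodgeConjecture-24832`, h413 = `stmt-HodgeConjecture-24833`) until rung 0
closes; this file asserts no named fact, closes no socket; count-neutral; §2∕§4 heads are CONDITIONAL on their displayed inequality letters (payable by ★ p859344 ∕ ★ p859280 modulo the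
continued family `F`).

## References
* [Iwaniec2002] H. Iwaniec, *Spectral Methods of Automorphic Forms*, 2nd ed. (2002), §6.3 (Maass–Selberg), §7 (p. 103).
* [Langlands1976] R. P. Langlands, *On the Functional Equations Satisfied by Eisenstein Series*, LNM 544 (1976), §7.
* [MoeglinWaldspurger1995] C. Mœglin, J.-L. Waldspurger, *Spectral decomposition and Eisenstein series* (1995), IV.2.3, IV.3.12.
-/

set_option autoImplicit false
set_option linter.dupNamespace false  -- the mandated namespace repeats the summit's segment (`HodgeConjecture.HodgeConjecture`)

noncomputable section

open Real Set MeasureTheory Measure NumberField IsDedekindDomain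
open scoped ENNReal NNReal
open Literature.MeasureTheory.Group Literature.NumberTheory.Automorphic Literature.NumberTheory.Automorphic.UnitaryGroup AdelicGroupData
open Summit.HodgeConjecture.HodgeConjecture.Cruxes.H413.K2E1BorelEisensteinU
open Summit.HodgeConjecture.HodgeConjecture.Cruxes.H413.K2E1MaassSelbergPairingFamilyCMTwo (poleControl_continued_cm_two_of_family poleControl_continued_cm_two_of_family_lower)
open Summit.HodgeConjecture.HodgeConjecture.Cruxes.H413.K2E1MaassSelbergSphericalBracketsCMThree (idelicBracket_pos)

namespace Summit.HodgeConjecture.HodgeConjecture.Cruxes.H413.K2E1ScatteringBoundMaassSelbergU2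

/-! ## §1 Real algebra: `s² ≤ A + B·s ⇒ s ≤ B + √A` -/

/-- **`s² ≤ A + B·s ⇒ s ≤ B + √A`** for `A, B ≥ 0` (any real `s`: if `s > B + √A ≥ 0` then `s² > s·B + s·√A ≥ B·s + A`). [folklore] -/
theorem le_add_sqrt_of_sq_le {s A B : ℝ} (hA : 0 ≤ A) (hB : 0 ≤ B) (h : s ^ 2 ≤ A + B * s) : s ≤ B + Real.sqrt A := by
  refine le_of_not_gt fun hlt => ?_
  have hr0 : 0 ≤ Real.sqrt A := Real.sqrt_nonneg A
  have hrr : Real.sqrt A * Real.sqrt A = A := Real.mul_self_sqrt hA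
  have hspos : 0 < s := lt_of_le_of_lt (add_nonneg hB hr0) hlt
  have h1 : s * (B + Real.sqrt A) < s * s := mul_lt_mul_of_pos_left hlt hspos
  have h2 : Real.sqrt A * Real.sqrt A ≤ s * Real.sqrt A :=
    mul_le_mul_of_nonneg_right (le_of_lt (lt_of_le_of_lt (le_add_of_nonneg_left hB) hlt)) hr0
  nlinarith [h1, h2, hrr, h]

/-! ## §2 The uniform bound on the strip `ρ₀ < Re z ≤ σ₀`, `|Im z| ≥ 1` -/

/-- **THE MS-BOUND, RANK PARAMETER `ρ₀`**: if `‖c z‖² ≤ T₀^{4(σ−ρ₀)} + 2(σ−ρ₀)·‖c z‖·T₀^{2(σ−ρ₀)}∕|t|` for `ρ₀ < σ = Re z ≤ σ₀`, `|t| = |Im z| ≥ 1` (`T₀ ≥ 1`), then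
`‖c z‖ ≤ B := (2σ₀ − 2ρ₀)·T₀^{2σ₀−2ρ₀} + T₀^{2σ₀−2ρ₀}` there (§1 with `A = T₀^{4(σ−ρ₀)} = (T₀^{2(σ−ρ₀)})²`, `B = 2(σ−ρ₀)T₀^{2(σ−ρ₀)}` after `1∕|t| ≤ 1`, then monotonicity in `σ`).
[cite: Iwaniec2002, §7 p. 103] [cite: Langlands1976, §7] -/
theorem exists_norm_le_of_maassSelberg_ineq (ρ₀ σ₀ T₀ : ℝ) (hσ₀ : ρ₀ < σ₀) (hT₀ : 1 ≤ T₀) {c : ℂ → ℂ}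
    (hMS : ∀ z : ℂ, ρ₀ < z.re → z.re ≤ σ₀ → 1 ≤ |z.im| →
      ‖c z‖ ^ 2 ≤ T₀ ^ (4 * (z.re - ρ₀)) + 2 * (z.re - ρ₀) * ‖c z‖ * T₀ ^ (2 * (z.re - ρ₀)) / |z.im|) :
    ∃ B : ℝ, 0 ≤ B ∧ ∀ z : ℂ, ρ₀ < z.re → z.re ≤ σ₀ → 1 ≤ |z.im| → ‖c z‖ ≤ B := by
  have hT₀0 : 0 < T₀ := zero_lt_one.trans_le hT₀
  have hP₀ : 0 ≤ T₀ ^ (2 * (σ₀ - ρ₀)) := Real.rpow_nonneg hT₀0.le _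
  refine ⟨2 * (σ₀ - ρ₀) * T₀ ^ (2 * (σ₀ - ρ₀)) + T₀ ^ (2 * (σ₀ - ρ₀)), add_nonneg (mul_nonneg (by linarith) hP₀) hP₀, fun z hz₁ hz₂ ht => ?_⟩
  set P : ℝ := T₀ ^ (2 * (z.re - ρ₀)) with hPdef
  have hP : 0 ≤ P := Real.rpow_nonneg hT₀0.le _
  have hx : 0 ≤ 2 * (z.re - ρ₀) := by linarith
  have h4 : T₀ ^ (4 * (z.re - ρ₀)) = P * P := by
    rw [hPdef, ← Real.rpow_add hT₀0]; congr 1; ring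
  -- `1∕|t| ≤ 1`
  have hdrop : 2 * (z.re - ρ₀) * ‖c z‖ * T₀ ^ (2 * (z.re - ρ₀)) / |z.im| ≤ (2 * (z.re - ρ₀) * P) * ‖c z‖ := by
    rw [← hPdef]
    calc 2 * (z.re - ρ₀) * ‖c z‖ * P / |z.im| ≤ 2 * (z.re - ρ₀) * ‖c z‖ * P := div_le_self (by positivity) ht
      _ = (2 * (z.re - ρ₀) * P) * ‖c z‖ := by ring
  have hsq : ‖c z‖ ^ 2 ≤ P * P + (2 * (z.re - ρ₀) * P) * ‖c z‖ := by
    have h := hMS z hz₁ hz₂ ht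
    rw [h4] at h
    linarith
  have h1 := le_add_sqrt_of_sq_le (mul_nonneg hP hP) (by positivity) hsq
  rw [Real.sqrt_mul_self hP] at h1
  -- monotonicity in `σ`
  have hPP : P ≤ T₀ ^ (2 * (σ₀ - ρ₀)) := Real.rpow_le_rpow_of_exponent_le hT₀ (by linarith)
  calc ‖c z‖ ≤ 2 * (z.re - ρ₀) * P + P := h1
    _ ≤ 2 * (σ₀ - ρ₀) * T₀ ^ (2 * (σ₀ - ρ₀)) + T₀ ^ (2 * (σ₀ - ρ₀)) :=
        add_le_add (mul_le_mul (by linarith) hPP hP (by linarith)) hPP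

/-- **HEAD — T1 (ROADCARD §3 FILE 1 bytes): THE SCATTERING SCALAR OF `U(1,1)_{L∕L⁺}` IS BOUNDED ON `½ < Re z ≤ σ₀`, `|Im z| ≥ 1`, FROM THE MAASS–SELBERG INEQUALITY.**  For `σ₀ > ½`,
`T₀ ≥ 1` and any `c : ℂ → ℂ` with `‖c z‖² ≤ T₀^{4σ−2} + (2σ−1)·‖c z‖·T₀^{2σ−1}∕|t|` on the strip (`σ = Re z`, `t = Im z`): `∃ B ≥ 0, ‖c z‖ ≤ B` there — `ρ₀ = ½` in
`exists_norm_le_of_maassSelberg_ineq` (`B = (2σ₀−1)·T₀^{2σ₀−1} + T₀^{2σ₀−1}`).  ζ-FREE: no growth of `ζ_{L⁺}`, no zero-free region, no Stirling. [cite: Iwaniec2002, §6.3 and §7 p. 103]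
[cite: Langlands1976, §7] [cite: MoeglinWaldspurger1995, IV.2.3, IV.3.12] -/
theorem norm_intertwiningScalar_le_of_maassSelberg (σ₀ T₀ : ℝ) (hσ₀ : 1 / 2 < σ₀) (hT₀ : 1 ≤ T₀) {c : ℂ → ℂ}
    (hMS : ∀ z : ℂ, 1 / 2 < z.re → z.re ≤ σ₀ → 1 ≤ |z.im| → ‖c z‖ ^ 2 ≤ T₀ ^ (4 * z.re - 2) + (2 * z.re - 1) * ‖c z‖ * T₀ ^ (2 * z.re - 1) / |z.im|) :
    ∃ B : ℝ, 0 ≤ B ∧ ∀ z : ℂ, 1 / 2 < z.re → z.re ≤ σ₀ → 1 ≤ |z.im| → ‖c z‖ ≤ B := by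
  refine exists_norm_le_of_maassSelberg_ineq (1 / 2) σ₀ T₀ hσ₀ hT₀ fun z hz₁ hz₂ ht => ?_
  have e1 : 4 * (z.re - 1 / 2) = 4 * z.re - 2 := by ring
  have e2 : 2 * (z.re - 1 / 2) = 2 * z.re - 1 := by ring
  rw [e1, e2]
  exact hMS z hz₁ hz₂ ht

/-- **T1 AT `N = 3`** (`U(2,1)_{L∕L⁺}`, `2ρ_H = 2`): the same on `1 < Re z ≤ σ₀`, `|Im z| ≥ 1` from `‖c z‖² ≤ T₀^{4σ−4} + (2σ−2)·‖c z‖·T₀^{2σ−2}∕|t|` — `ρ₀ = 1`.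
[cite: Langlands1976, §7] [cite: MoeglinWaldspurger1995, IV.2.3, IV.3.12] -/
theorem norm_intertwiningScalar_le_of_maassSelberg_three (σ₀ T₀ : ℝ) (hσ₀ : 1 < σ₀) (hT₀ : 1 ≤ T₀) {c : ℂ → ℂ}
    (hMS : ∀ z : ℂ, 1 < z.re → z.re ≤ σ₀ → 1 ≤ |z.im| → ‖c z‖ ^ 2 ≤ T₀ ^ (4 * z.re - 4) + (2 * z.re - 2) * ‖c z‖ * T₀ ^ (2 * z.re - 2) / |z.im|) :
    ∃ B : ℝ, 0 ≤ B ∧ ∀ z : ℂ, 1 < z.re → z.re ≤ σ₀ → 1 ≤ |z.im| → ‖c z‖ ≤ B := by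
  refine exists_norm_le_of_maassSelberg_ineq 1 σ₀ T₀ hσ₀ hT₀ fun z hz₁ hz₂ ht => ?_
  have e1 : 4 * (z.re - 1) = 4 * z.re - 4 := by ring
  have e2 : 2 * (z.re - 1) = 2 * z.re - 2 := by ring
  rw [e1, e2]
  exact hMS z hz₁ hz₂ ht

/-! ## §3 The Maass–Selberg inequality `‖c‖² ≤ T^{4x} + 2x‖c‖T^{2x}∕|y|` from the scalar Maass–Selberg currency of ★ p857974 -/

/-- **`hMS` FROM THE DIAGONAL MAASS–SELBERG RELATION** (the currency of ★ `K2E1MaassSelbergPoleInequality` ∕ ★ `maassSelbergDiag_of_fourTerm`): `a > 0`, `s ≥ 0` (`s = ‖c(z)‖`), `b = a·s²`,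
`T > 0`, `x > 0` (`x = Re z − ρ₀`), `y ≠ 0` (`y = Im z`), an oscillatory term `e` with `|e| ≤ √(a·b)∕|y|` (★ `abs_im_mul_div_le`), and `0 ≤ a·T^{2x}∕(2x) − b·T^{−2x}∕(2x) + e`.  THEN
**`s² ≤ T^{4x} + 2x·s·T^{2x}∕|y|`** (multiply by `2x·T^{2x}∕a`; `√(a·(a s²)) = a·s`). [cite: MoeglinWaldspurger1995, IV.2.3, IV.3.12] [cite: Langlands1976, §7] -/
theorem sq_le_of_maassSelbergDiag {a s T x y e : ℝ} (ha : 0 < a) (hs : 0 ≤ s) (hT : 0 < T) (hx : 0 < x) (hy : y ≠ 0)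
    (he : |e| ≤ Real.sqrt (a * (a * s ^ 2)) / |y|) (hMS : 0 ≤ a * T ^ (2 * x) / (2 * x) - (a * s ^ 2) * T ^ (-(2 * x)) / (2 * x) + e) :
    s ^ 2 ≤ T ^ (4 * x) + 2 * x * s * T ^ (2 * x) / |y| := by
  set P : ℝ := T ^ (2 * x) with hPdef
  have hP : 0 < P := Real.rpow_pos_of_pos hT _
  have hy' : 0 < |y| := abs_pos.2 hy
  have h4 : T ^ (4 * x) = P * P := by rw [hPdef, ← Real.rpow_add hT]; congr 1; ring
  have hneg : T ^ (-(2 * x)) = P⁻¹ := by rw [Real.rpow_neg hT.le, ← hPdef]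
  have hsqrt : Real.sqrt (a * (a * s ^ 2)) = a * s := by
    rw [show a * (a * s ^ 2) = (a * s) ^ 2 by ring, Real.sqrt_sq (mul_nonneg ha.le hs)]
  have he' : e ≤ a * s / |y| := (le_abs_self e).trans (by rwa [hsqrt] at he)
  rw [hneg] at hMS
  -- `a s² P⁻¹∕(2x) ≤ a P∕(2x) + a s∕|y|`, multiplied by `2x·P∕a > 0`
  have key : a * s ^ 2 * P⁻¹ / (2 * x) ≤ a * P / (2 * x) + a * s / |y| := by linarith
  have hmul := mul_le_mul_of_nonneg_left key (le_of_lt (by positivity : (0 : ℝ) < 2 * x * P / a))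
  have ha' : a ≠ 0 := ha.ne'
  have hx' : (2 : ℝ) * x ≠ 0 := by positivity
  have hP' : P ≠ 0 := hP.ne'
  have hy'' : |y| ≠ 0 := hy'.ne'
  have e1 : 2 * x * P / a * (a * s ^ 2 * P⁻¹ / (2 * x)) = s ^ 2 := by field_simp
  have e2 : 2 * x * P / a * (a * P / (2 * x) + a * s / |y|) = P * P + 2 * x * s * P / |y| := by
    field_simp
  rw [e1, e2] at hmul
  rwa [h4]

/-! ## §4 The same uniform bound read off a «box» bound of (a2)-shape -/

/-- **FROM A BOX BOUND TO `‖c z‖ ≤ B`**: if `κ·m·‖c z‖²·‖φ₀‖² ≤ M` for `z` in a set `S` (the shape of conclusion (a2) of ★ `poleControl_continued_cm_two_of_pairing` ∕ `…_of_family` with `x₁ := Re z − ρ₀`,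
`x₂ := σ₀ − ρ₀`, `η := 1`), `κ, m > 0`, `φ₀ ≠ 0`, then `‖c z‖ ≤ √(M ∕ (κ·m·‖φ₀‖²))` on `S`. [cite: MoeglinWaldspurger1995, IV.3.12 (a)] -/
theorem exists_norm_le_of_box_bound {κ m M : ℝ} {φ₀ : ℂ} (hκ : 0 < κ) (hm : 0 < m) (hφ₀ : φ₀ ≠ 0) {c : ℂ → ℂ} {S : Set ℂ}
    (hbox : ∀ z ∈ S, κ * m * ‖c z‖ ^ 2 * ‖φ₀‖ ^ 2 ≤ M) :
    ∃ B : ℝ, 0 ≤ B ∧ ∀ z ∈ S, ‖c z‖ ≤ B := by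
  have hφ : 0 < ‖φ₀‖ ^ 2 := by positivity
  have ha : 0 < κ * m * ‖φ₀‖ ^ 2 := by positivity
  refine ⟨Real.sqrt (M / (κ * m * ‖φ₀‖ ^ 2)), Real.sqrt_nonneg _, fun z hz => ?_⟩
  have h1 : ‖c z‖ ^ 2 ≤ M / (κ * m * ‖φ₀‖ ^ 2) := by
    rw [le_div_iff₀ ha]
    calc ‖c z‖ ^ 2 * (κ * m * ‖φ₀‖ ^ 2) = κ * m * ‖c z‖ ^ 2 * ‖φ₀‖ ^ 2 := by ring
      _ ≤ M := hbox z hz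
  calc ‖c z‖ = |‖c z‖| := (abs_of_nonneg (norm_nonneg _)).symm
    _ ≤ Real.sqrt (M / (κ * m * ‖φ₀‖ ^ 2)) := Real.abs_le_sqrt h1

/-! ## §5 T1 PAID at `N = 2` modulo the operator-road socket (★ p859344): `‖c z‖ ≤ B` on `½ < Re z ≤ σ₀`, `|Im z| ≥ 1` -/

section Family

variable (L : Type) [Field L] [NumberField L] [IsCMField L]
variable [MeasurableSpace (quasiSplit (↥(maximalRealSubfield L)) L (IsCMField.complexConj L) 2).Adelic] [BorelSpace (quasiSplit (↥(maximalRealSubfield L)) L (IsCMField.complexConj L) 2).Adelic]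
variable [MeasurableSpace (AdeleRing (𝓞 L) L)ˣ] [BorelSpace (AdeleRing (𝓞 L) L)ˣ]

/-- **T1 FROM THE OPERATOR-ROAD SOCKET (`N = 2`).**  Structural data of ★ (R6k)₂; `φ₀ ≠ 0`; the continued scalar `c` holomorphic on BOTH quadrants `D± = {Re > ½, Im ≷ 0}` with (hceq) on the
tube; `L²(X,μ)`-holomorphic extensions `F₊` on `D⁺`, `F₋` on `D⁻` of the truncated spherical Eisenstein classes (the sockets of ★ p859344).  THEN for every real `σ₀` (the strip is empty unless `σ₀ > ½`):
**`∃ B ≥ 0, ∀ z, ½ < Re z ≤ σ₀ → 1 ≤ |Im z| → ‖c z‖ ≤ B`** — the box conclusion (a2) of ★ `poleControl_continued_cm_two_of_family[_lower]` at `x₁ := Re z − ½`, `x₂ := σ₀ − ½`, `η := 1` on the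
quadrant containing `z`, then §4 (`κ_ℝ > 0` ★ `idelicBracket_pos`, `m > 0` ★ `measureReal_maximalCompact_pos`).  This is ROADCARD T1 ∕ G-T1 «★ modulo the (24)∕(55) socket». [cite: MoeglinWaldspurger1995, IV.3.12 (a)]
[cite: Langlands1976, §7] [cite: Iwaniec2002, §7 p. 103] -/
theorem exists_norm_intertwiningScalar_le_of_family
    (μ : Measure (quasiSplit (↥(maximalRealSubfield L)) L (IsCMField.complexConj L) 2).automorphicQuotient) [(quasiSplit (↥(maximalRealSubfield L)) L (IsCMField.complexConj L) 2).IsAutomorphicMeasure μ]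
    (νG : Measure (quasiSplit (↥(maximalRealSubfield L)) L (IsCMField.complexConj L) 2).Adelic) [νG.IsHaarMeasure] [νG.IsInvInvariant]
    (μK : Measure ((standardMaximalCompactGL 2 L).comap (adelicVal (↥(maximalRealSubfield L)) L (IsCMField.complexConj L) 2 ((StdForm.antidiagonal 2).over L)) : Subgroup (quasiSplit (↥(maximalRealSubfield L)) L (IsCMField.complexConj L) 2).Adelic))
    [μK.IsHaarMeasure]
    (νI : Measure (AdeleRing (𝓞 L) L)ˣ) [νI.IsHaarMeasure]
    {𝓕I : Set (AdeleRing (𝓞 L) L)ˣ} (h𝓕I : IsIdeleClassDomain L 𝓕I)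
    (ν : Measure ↥(adelicUnipotent (↥(maximalRealSubfield L)) L (IsCMField.complexConj L) 2)) [ν.IsHaarMeasure]
    {𝓕 : Set ↥(adelicUnipotent (↥(maximalRealSubfield L)) L (IsCMField.complexConj L) 2)} (h𝓕N : IsFundamentalDomain ↥(rationalUnipotent (↥(maximalRealSubfield L)) L (IsCMField.complexConj L) 2) 𝓕 ν) (h𝓕1 : ν 𝓕 = 1)
    (h𝓕c : IsCompact (closure 𝓕))
    {T : ℝ≥0} (hT : 1 ≤ T) {φ₀ : ℂ} (hφ₀ : φ₀ ≠ 0)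
    {β : (quasiSplit (↥(maximalRealSubfield L)) L (IsCMField.complexConj L) 2).Adelic → ℝ≥0∞} (hβ : IsCoveringWeight ((arithmeticBorel (↥(maximalRealSubfield L)) L (IsCMField.complexConj L) 2).map (quasiSplit (↥(maximalRealSubfield L)) L (IsCMField.complexConj L) 2).arithmeticSubgroup.subtype) β)
    {c : ℂ → ℂ} (hcU : DifferentiableOn ℂ c {z : ℂ | 1 / 2 < z.re ∧ 0 < z.im}) (hcL : DifferentiableOn ℂ c {w : ℂ | 1 / 2 < w.re ∧ w.im < 0})
    (hceq : ∀ z : ℂ, 1 < z.re → c z = (∫ v : ↥(adelicUnipotent (↥(maximalRealSubfield L)) L (IsCMField.complexConj L) 2), (((borelHeight ((quasiSplit (↥(maximalRealSubfield L)) L (IsCMField.complexConj L) 2).toAdelic (weylLongU ((IsCMField.complexConj L : L ≃ₐ[↥(maximalRealSubfield L)] L) : L →+* L) (rfl : (StdForm.antidiagonal 2).over L = (StdForm.antidiagonal 2).over L)) * (v : (quasiSplit (↥(maximalRealSubfield L)) L (IsCMField.complexConj L) 2).Adelic))) : ℝ) : ℂ) ^ z ∂ν))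
    (FU : ℂ → Lp ℂ 2 μ) (hFUd : DifferentiableOn ℂ FU {z : ℂ | 1 / 2 < z.re ∧ 0 < z.im})
    (hFUtube : ∀ z ∈ {z : ℂ | 1 / 2 < z.re ∧ 0 < z.im}, 1 < z.re → ((FU z : Lp ℂ 2 μ) : (quasiSplit (↥(maximalRealSubfield L)) L (IsCMField.complexConj L) 2).automorphicQuotient → ℂ) =ᵐ[μ] (quasiSplit (↥(maximalRealSubfield L)) L (IsCMField.complexConj L) 2).quotFun (truncation ν 𝓕 T (eisensteinSeriesU (flatSectionU (fun _ : (quasiSplit (↥(maximalRealSubfield L)) L (IsCMField.complexConj L) 2).Adelic => φ₀) z))))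
    (FL : ℂ → Lp ℂ 2 μ) (hFLd : DifferentiableOn ℂ FL {w : ℂ | 1 / 2 < w.re ∧ w.im < 0})
    (hFLtube : ∀ z ∈ {w : ℂ | 1 / 2 < w.re ∧ w.im < 0}, 1 < z.re → ((FL z : Lp ℂ 2 μ) : (quasiSplit (↥(maximalRealSubfield L)) L (IsCMField.complexConj L) 2).automorphicQuotient → ℂ) =ᵐ[μ] (quasiSplit (↥(maximalRealSubfield L)) L (IsCMField.complexConj L) 2).quotFun (truncation ν 𝓕 T (eisensteinSeriesU (flatSectionU (fun _ : (quasiSplit (↥(maximalRealSubfield L)) L (IsCMField.complexConj L) 2).Adelic => φ₀) z))))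
    (σ₀ : ℝ) :
    ∃ B : ℝ, 0 ≤ B ∧ ∀ z : ℂ, 1 / 2 < z.re → z.re ≤ σ₀ → 1 ≤ |z.im| → ‖c z‖ ≤ B := by
  have hκr : 0 < (∫ x in {x : (AdeleRing (𝓞 L) L)ˣ | (IdeleClassGroup.ideleNorm L x : ℝ) ≤ 1} ∩ 𝓕I, (IdeleClassGroup.ideleNorm L x : ℝ) ∂νI) := idelicBracket_pos νI h𝓕I
  have hmK : 0 < μK.real Set.univ := K2E1MaassSelbergSphericalBracketsCMTwo.measureReal_maximalCompact_pos μK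
  -- the box bound on the strip, quadrant by quadrant
  refine (exists_norm_le_of_box_bound (c := c) (S := {z : ℂ | 1 / 2 < z.re ∧ z.re ≤ σ₀ ∧ 1 ≤ |z.im|}) hκr hmK hφ₀
    (M := ((σ₀ - 1 / 2) * (T : ℝ) ^ (2 * (σ₀ - 1 / 2)) * Real.sqrt ((∫ x in {x : (AdeleRing (𝓞 L) L)ˣ | (IdeleClassGroup.ideleNorm L x : ℝ) ≤ 1} ∩ 𝓕I, (IdeleClassGroup.ideleNorm L x : ℝ) ∂νI) * μK.real Set.univ * ‖φ₀‖ ^ 2) / 1 +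
      Real.sqrt ((σ₀ - 1 / 2) ^ 2 * (T : ℝ) ^ (4 * (σ₀ - 1 / 2)) * ((∫ x in {x : (AdeleRing (𝓞 L) L)ˣ | (IdeleClassGroup.ideleNorm L x : ℝ) ≤ 1} ∩ 𝓕I, (IdeleClassGroup.ideleNorm L x : ℝ) ∂νI) * μK.real Set.univ * ‖φ₀‖ ^ 2) / 1 ^ 2 + ((∫ x in {x : (AdeleRing (𝓞 L) L)ˣ | (IdeleClassGroup.ideleNorm L x : ℝ) ≤ 1} ∩ 𝓕I, (IdeleClassGroup.ideleNorm L x : ℝ) ∂νI) * μK.real Set.univ * ‖φ₀‖ ^ 2) * (T : ℝ) ^ (4 * (σ₀ - 1 / 2)))) ^ 2)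
    (fun z hz => ?_)).imp fun B hB => ⟨hB.1, fun z h₁ h₂ h₃ => hB.2 z ⟨h₁, h₂, h₃⟩⟩
  obtain ⟨hz₁, hz₂, ht⟩ := hz
  have him : z.im ≠ 0 := fun h0 => by rw [h0, abs_zero] at ht; exact absurd ht (by norm_num)
  rcases lt_or_gt_of_ne him with hneg | hpos
  · obtain ⟨-, h2, -⟩ := poleControl_continued_cm_two_of_family_lower L μ νG μK νI h𝓕I ν h𝓕N h𝓕1 h𝓕c hT hφ₀ hβ hcL hceq FL hFLd hFLtube (z := z) ⟨hz₁, hneg⟩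
    exact @h2 (z.re - 1 / 2) (σ₀ - 1 / 2) 1 (by linarith) ⟨le_rfl, by linarith⟩ one_pos ht
  · obtain ⟨-, h2, -⟩ := poleControl_continued_cm_two_of_family L μ νG μK νI h𝓕I ν h𝓕N h𝓕1 h𝓕c hT hφ₀ hβ hcU hceq FU hFUd hFUtube (z := z) ⟨hz₁, hpos⟩
    exact @h2 (z.re - 1 / 2) (σ₀ - 1 / 2) 1 (by linarith) ⟨le_rfl, by linarith⟩ one_pos ht

end Family

end Summit.HodgeConjecture.HodgeConjecture.Cruxes.H413.K2E1ScatteringBoundMaassSelbergU2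

end
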